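import Literature.Geometry.GeometricMeasureTheory.AllardIntegralDensityOfLimits
import Literature.MeasureTheory.Hausdorff.SphereCapAsymptotics
import Literature.Geometry.Riemannian.SphericalCylinderEntropy
import Literature.Geometry.Manifold.CylinderSlice
import HarnessLib

/-!
# The Allard density conclusion holds with `N = 1` on every static slice `S⁴ × {c}`

Normalisation / non-vacuity check of the named fact
`Literature.Geometry.GeometricMeasureTheory.Allard1972_integralDensityOfLimits_cylinderCrossSections`
(line `killing-flux`, crux `CylinderRungTwo`, stmt-SmoothPoincare4-7631): for the constant sequence
`ι_k = sliceMap c` the weak limit of the area measures is `μ = μH[4]⌊(S⁴ × {c})`, and the `4`-density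
`μ(B(x,r)) / μH[4](B⁴(0,r))` of this measure — Mathlib's UN-normalised `μH[4]` upstairs in `ℝ⁶` and
in the normaliser (a ball of `EuclideanSpace ℝ (Fin 4)`) — tends to `1` at EVERY point `x` of the
slice, hence the conclusion of the named fact holds `μ`-a.e. with `N = 1`.

Proof: the slice is the isometric image `sliceMap c '' S⁴` of the unit sphere of `ℝ⁵`
(`isometry_sliceMap`), so `μH[4](B(sliceMap c q, r) ∩ slice) = μH[4](S⁴ ∩ B(q, r))`
(`Isometry.hausdorffMeasure_preimage`, `Isometry.preimage_ball`, twice: for `sliceMap c` and for the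
subtype inclusion `S⁴ ↪ ℝ⁵`), and small caps of `S⁴` are asymptotically flat `4`-discs for `μH[4]`
(`Literature.MeasureTheory.Hausdorff.tendsto_hausdorffMeasure_sphere_inter_ball_div_fin`).
-/

noncomputable section

open MeasureTheory Set Filter
open scoped ENNReal NNReal Topology BigOperators

set_option linter.dupNamespace false

namespace Summit.SmoothPoincare4.SmoothPoincare4.Cruxes.CylinderRungTwo.KillingFlux

open Literature.Geometry.Manifold.CylinderSlice
open Literature.Geometry.Riemannian.SphericalCylinderEntropy
open Literature.MeasureTheory.Hausdorff

/-- **Slice caps are sphere caps.** For `q ∈ S⁴` and `x = sliceMap c q = (q, c)`, the part of the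
slice `S⁴ × {c} = range (sliceMap c)` in the ball `B(x, r)` of `ℝ⁶` has the `μH[4]`-measure of the cap
`S⁴ ∩ B(q, r)` of the unit sphere of `ℝ⁵` (two isometries: `sliceMap c` and the inclusion
`S⁴ ↪ ℝ⁵`). [folklore] -/
theorem hausdorffMeasure_ball_sliceMap_inter_range (c : ℝ)
    (q : Metric.sphere (0 : EuclideanSpace ℝ (Fin 5)) 1) (r : ℝ) :
    μH[4] (Metric.ball (sliceMap c q) r ∩ Set.range (sliceMap c)) =
      μH[4] (Metric.sphere (0 : EuclideanSpace ℝ (Fin 5)) 1 ∩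
        Metric.ball (q : EuclideanSpace ℝ (Fin 5)) r) := by
  rw [← (isometry_sliceMap c).hausdorffMeasure_preimage (Or.inl (by norm_num)),
    (isometry_sliceMap c).preimage_ball q r,
    ← (isometry_subtype_coe (s := Metric.sphere (0 : EuclideanSpace ℝ (Fin 5)) 1)).preimage_ball q r,
    (isometry_subtype_coe (s := Metric.sphere (0 : EuclideanSpace ℝ (Fin 5)) 1)).hausdorffMeasure_preimage
      (Or.inl (by norm_num)),
    Subtype.range_coe, Set.inter_comm]

/-- **Density one at every point of a slice.** For `q ∈ S⁴` and `x = sliceMap c q`, the `4`-density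
of `μH[4]⌊(S⁴ × {c})` at `x`, normalised by `μH[4]` of the `4`-ball of `EuclideanSpace ℝ (Fin 4)`
(the normalisation of the Allard named fact), tends to `1` as `r → 0⁺`. [folklore] -/
theorem tendsto_hausdorffMeasure_ball_inter_range_sliceMap_div (c : ℝ)
    (q : Metric.sphere (0 : EuclideanSpace ℝ (Fin 5)) 1) :
    Filter.Tendsto (fun r : ℝ =>
        μH[4] (Metric.ball (sliceMap c q) r ∩ Set.range (sliceMap c)) /
          μH[4] (Metric.ball (0 : EuclideanSpace ℝ (Fin 4)) r))
      (𝓝[>] 0) (𝓝 1) := by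
  simp_rw [hausdorffMeasure_ball_sliceMap_inter_range]
  exact tendsto_hausdorffMeasure_sphere_inter_ball_div_fin (sum_sq_eq_one q)

/-- **Density one at every point of a slice, restricted-measure form.** For every `x` in the slice
`{z | ∑_{i<5} zᵢ² = 1 ∧ z₅ = c}`, `(μH[4]⌊slice)(B(x,r)) / μH[4](B⁴(0,r)) → 1` as `r → 0⁺`. [folklore] -/
theorem tendsto_restrict_slice_ball_div (c : ℝ) {x : EuclideanSpace ℝ (Fin 6)}
    (hx : x ∈ {z : EuclideanSpace ℝ (Fin 6) | ∑ i : Fin 5, z (Fin.castSucc i) ^ 2 = 1 ∧ z 5 = c}) :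
    Filter.Tendsto (fun r : ℝ =>
        ((μH[4] : MeasureTheory.Measure (EuclideanSpace ℝ (Fin 6))).restrict
            {z : EuclideanSpace ℝ (Fin 6) | ∑ i : Fin 5, z (Fin.castSucc i) ^ 2 = 1 ∧ z 5 = c})
          (Metric.ball x r) / μH[4] (Metric.ball (0 : EuclideanSpace ℝ (Fin 4)) r))
      (𝓝[>] 0) (𝓝 1) := by
  rw [← range_sliceMap c] at hx ⊢
  obtain ⟨q, rfl⟩ := hx
  simp_rw [Measure.restrict_apply Metric.isOpen_ball.measurableSet]
  exact tendsto_hausdorffMeasure_ball_inter_range_sliceMap_div c q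

/-- **The conclusion of the Allard named fact holds, with `N = 1`, for the area measure of every
slice `S⁴ × {c}`** (normalisation check of
`Literature.Geometry.GeometricMeasureTheory.Allard1972_integralDensityOfLimits_cylinderCrossSections`
on the model case of the constant sequence `ι_k = sliceMap c`, whose weak limit is `μH[4]⌊slice`):
for `μH[4]⌊slice`-a.e. `x` (indeed for every `x` in the slice) the `4`-density
`(μH[4]⌊slice)(B(x,r)) / μH[4](B⁴(0,r))` tends to the positive integer `1`. [folklore] -/
theorem helper_allardDensityStaticSlice : ∀ c : ℝ, ∀ᵐ x ∂((μH[4] : MeasureTheory.Measure (EuclideanSpace ℝ (Fin 6))).restrict {z : EuclideanSpace ℝ (Fin 6) | ∑ i : Fin 5, z (Fin.castSucc i) ^ 2 = 1 ∧ z 5 = c}), ∃ N : ℕ, 0 < N ∧ Filter.Tendsto (fun r : ℝ => ((μH[4] : MeasureTheory.Measure (EuclideanSpace ℝ (Fin 6))).restrict {z : EuclideanSpace ℝ (Fin 6) | ∑ i : Fin 5, z (Fin.castSucc i) ^ 2 = 1 ∧ z 5 = c}) (Metric.ball x r) / μH[4] (Metric.ball (0 : EuclideanSpace ℝ (Fin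 4)) r)) (𝓝[>] 0) (𝓝 (N : ℝ≥0∞)) := by
  intro c
  have hmeas : MeasurableSet
      {z : EuclideanSpace ℝ (Fin 6) | ∑ i : Fin 5, z (Fin.castSucc i) ^ 2 = 1 ∧ z 5 = c} := by
    rw [← range_sliceMap c]
    exact measurableSet_range_sliceMap c
  rw [ae_restrict_iff' hmeas]
  refine ae_of_all _ fun x hx => ⟨1, one_pos, ?_⟩
  rw [Nat.cast_one]
  exact tendsto_restrict_slice_ball_div c hx

end Summit.SmoothPoincare4.SmoothPoincare4.Cruxes.CylinderRungTwo.KillingFlux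

end
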